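import Summits.AtomisticToContinuum.BoseEinsteinCondensation.Theorems.BECHeatBathGapSomeNearMinimiserCondenses
import Literature.MathematicalPhysics.QuantumManyBody.OneParticleMarginals
import Literature.MathematicalPhysics.QuantumManyBody.LiebYngvasonBoxBound
import HarnessLib

/-!
# Route `BECHeatBathGap`, crux `SquareSummableInfluence` (stmt-AtomisticToContinuum-14368),
# line `registered`: the registered stub `stub_influenceLipschitz`

Supports (does not close) stmt-AtomisticToContinuum-14368; stub `stub_influenceLipschitz` of line
`registered` (skeleton v2).

**The influence sum is `L²`-Lipschitz in the bath state.** For measurable `Ψ : Λ^{N+1} → ℂ`,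
`Θ, Θ' : Λ^N → ℂ`, measurable predictors `g_i : Λ^{N+1} → ℂ` with `‖g_i‖ ≤ M`, and a scalar `c`:

`∑_i ∫_{Λ_L^{N+1}} |Ψ(Z) − c g_i(Z) Θ'(tail Z)|²`
`  ≤ 2 ∑_i ∫_{Λ_L^{N+1}} |Ψ(Z) − g_i(Z) Θ(tail Z)|² + 2 N M² L³ ∫ |Θ − c Θ'|²`.

## Proof

Pointwise `Ψ − c g_i Θ'(tail) = (Ψ − g_i Θ(tail)) + g_i · (Θ − c Θ')(tail)`, so
`|Ψ − c g_i Θ'(tail)|² ≤ 2|Ψ − g_i Θ(tail)|² + 2 M² F(tail Z)` with `F = |Θ − c Θ'|²`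
(`|a + b|² ≤ 2|a|² + 2|b|²`, `|g_i| ≤ M`). Integrating over `Λ_L^{N+1}` and using Tonelli over
`Λ_L × Λ_L^N ≅ Λ_L^{N+1}` (`setLIntegral_box_boxN_vecCons`):
`∫_{Λ_L^{N+1}} F(tail Z) dZ = |Λ_L| ∫_{Λ_L^N} F ≤ L³ ∫ F` (`volume_box`; for `L ≤ 0` both sides
vanish). Summing the `N` identical second terms gives the claim.

No new definitions; `[folklore]`.
-/

noncomputable section

open MeasureTheory Filter
open scoped ENNReal NNReal

namespace Summit.AtomisticToContinuum.BoseEinsteinCondensation.Theorems.SquareSummableInfluence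

open Literature.MathematicalPhysics.QuantumManyBody.BoseGas

/-! ### Bookkeeping lemmas -/

/-- `|a + b|² ≤ 2|a|² + 2|b|²` for complex numbers, in `ℝ≥0∞`. [folklore] -/
private theorem coe_nnnorm_add_sq_le_two_mul (a b : ℂ) :
    (‖a + b‖₊ : ℝ≥0∞) ^ 2 ≤ 2 * (‖a‖₊ : ℝ≥0∞) ^ 2 + 2 * (‖b‖₊ : ℝ≥0∞) ^ 2 := by
  have h : ‖a + b‖₊ ^ 2 ≤ 2 * ‖a‖₊ ^ 2 + 2 * ‖b‖₊ ^ 2 := by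
    rw [← NNReal.coe_le_coe]
    push_cast
    have h1 : ‖a + b‖ ≤ ‖a‖ + ‖b‖ := norm_add_le a b
    have h2 : ‖a + b‖ ^ 2 ≤ (‖a‖ + ‖b‖) ^ 2 := by
      have h0 : 0 ≤ ‖a + b‖ := norm_nonneg _
      nlinarith [h1, h0]
    nlinarith [h2, sq_nonneg (‖a‖ - ‖b‖)]
  exact_mod_cast h

/-- `‖g‖ ≤ M` gives `‖g‖₊² ≤ M²` in `ℝ≥0∞`. [folklore] -/
private theorem coe_nnnorm_sq_le_ofReal_sq {g : ℂ} {M : ℝ} (hg : ‖g‖ ≤ M) :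
    (‖g‖₊ : ℝ≥0∞) ^ 2 ≤ ENNReal.ofReal (M ^ 2) := by
  rw [coe_nnnorm_sq_eq_ofReal]
  exact ENNReal.ofReal_le_ofReal (pow_le_pow_left₀ (norm_nonneg _) hg 2)

/-- The pointwise step: `|ψ − c g θ'|² ≤ 2|ψ − g θ|² + 2 M² |θ − c θ'|²` when `|g| ≤ M`
(`ψ − c g θ' = (ψ − g θ) + g (θ − c θ')`). [folklore] -/
private theorem pointwise_influence_bound (ψ g θ θ' c : ℂ) {M : ℝ} (hg : ‖g‖ ≤ M) :
    (‖ψ - c * g * θ'‖₊ : ℝ≥0∞) ^ 2 ≤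
      2 * (‖ψ - g * θ‖₊ : ℝ≥0∞) ^ 2 +
        2 * ENNReal.ofReal (M ^ 2) * (‖θ - c * θ'‖₊ : ℝ≥0∞) ^ 2 := by
  have e : ψ - c * g * θ' = (ψ - g * θ) + g * (θ - c * θ') := by ring
  calc (‖ψ - c * g * θ'‖₊ : ℝ≥0∞) ^ 2
      = (‖(ψ - g * θ) + g * (θ - c * θ')‖₊ : ℝ≥0∞) ^ 2 := by rw [e]
    _ ≤ 2 * (‖ψ - g * θ‖₊ : ℝ≥0∞) ^ 2 + 2 * (‖g * (θ - c * θ')‖₊ : ℝ≥0∞) ^ 2 :=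
        coe_nnnorm_add_sq_le_two_mul _ _
    _ = 2 * (‖ψ - g * θ‖₊ : ℝ≥0∞) ^ 2 +
          2 * ((‖g‖₊ : ℝ≥0∞) ^ 2 * (‖θ - c * θ'‖₊ : ℝ≥0∞) ^ 2) := by
        rw [nnnorm_mul, ENNReal.coe_mul, mul_pow]
    _ ≤ 2 * (‖ψ - g * θ‖₊ : ℝ≥0∞) ^ 2 +
          2 * (ENNReal.ofReal (M ^ 2) * (‖θ - c * θ'‖₊ : ℝ≥0∞) ^ 2) := by
        gcongr
        exact coe_nnnorm_sq_le_ofReal_sq hg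
    _ = _ := by ring

/-- `ofReal (M²) · (ofReal L)³ ≤ ofReal (M² L³)` (equality for `L ≥ 0`; for `L < 0` the left side
vanishes). [folklore] -/
private theorem ofReal_sq_mul_ofReal_pow_three_le (M L : ℝ) :
    ENNReal.ofReal (M ^ 2) * ENNReal.ofReal L ^ 3 ≤ ENNReal.ofReal (M ^ 2 * L ^ 3) := by
  rcases le_or_gt 0 L with hL | hL
  · rw [← ENNReal.ofReal_pow hL, ← ENNReal.ofReal_mul (sq_nonneg M)]
  · simp [ENNReal.ofReal_of_nonpos hL.le]

/-- **Tonelli step**: for measurable `F ≥ 0` on `Λ^N`,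
`∫_{Λ_L^{N+1}} F(tail Z) dZ = (∫_{Λ_L^N} F) · |Λ_L| = (∫_{Λ_L^N} F) · L³`. [folklore] -/
private theorem setLIntegral_boxN_succ_comp_vecTail {N : ℕ} (L : ℝ) {F : Config N → ℝ≥0∞}
    (hF : Measurable F) :
    ∫⁻ Z in boxN (N + 1) L, F (Matrix.vecTail Z) =
      (∫⁻ X in boxN N L, F X) * ENNReal.ofReal L ^ 3 := by
  have hFt : Measurable fun Z : Config (N + 1) => F (Matrix.vecTail Z) :=
    hF.comp measurable_vecTail
  rw [← setLIntegral_box_boxN_vecCons L hFt]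
  simp only [Matrix.tail_cons]
  rw [setLIntegral_const, volume_box]

/-- **One term of the influence sum**: for measurable data with `‖g‖ ≤ M`,
`∫_{Λ_L^{N+1}} |Ψ − c g Θ'(tail)|² ≤ 2 ∫_{Λ_L^{N+1}} |Ψ − g Θ(tail)|² + 2 M² L³ ∫ |Θ − c Θ'|²`.
[folklore] -/
private theorem influence_term_bound (N : ℕ) (L : ℝ) (Ψ : Config (N + 1) → ℂ)
    (Θ Θ' : Config N → ℂ) (g : Config (N + 1) → ℂ) (M : ℝ) (c : ℂ)
    (hΨ : Measurable Ψ) (hΘ : Measurable Θ) (hΘ' : Measurable Θ') (hg : Measurable g)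
    (hgM : ∀ Z, ‖g Z‖ ≤ M) :
    ∫⁻ Z in boxN (N + 1) L, (‖Ψ Z - c * g Z * Θ' (Matrix.vecTail Z)‖₊ : ℝ≥0∞) ^ 2 ≤
      2 * (∫⁻ Z in boxN (N + 1) L, (‖Ψ Z - g Z * Θ (Matrix.vecTail Z)‖₊ : ℝ≥0∞) ^ 2) +
        2 * ENNReal.ofReal (M ^ 2 * L ^ 3) * ∫⁻ X, (‖Θ X - c * Θ' X‖₊ : ℝ≥0∞) ^ 2 := by
  -- the fluctuation `F = |Θ − c Θ'|²` and the measurability bookkeeping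
  obtain ⟨F, hFdef⟩ : ∃ F : Config N → ℝ≥0∞, F = fun X => (‖Θ X - c * Θ' X‖₊ : ℝ≥0∞) ^ 2 :=
    ⟨_, rfl⟩
  have hFm : Measurable F := by
    rw [hFdef]
    exact (hΘ.sub (hΘ'.const_mul c)).nnnorm.coe_nnreal_ennreal.pow_const 2
  have hFt : Measurable fun Z : Config (N + 1) => F (Matrix.vecTail Z) :=
    hFm.comp measurable_vecTail
  have hA : Measurable fun Z : Config (N + 1) =>
      (‖Ψ Z - g Z * Θ (Matrix.vecTail Z)‖₊ : ℝ≥0∞) ^ 2 :=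
    (hΨ.sub (hg.mul (hΘ.comp measurable_vecTail))).nnnorm.coe_nnreal_ennreal.pow_const 2
  have hA2 : Measurable fun Z : Config (N + 1) =>
      2 * (‖Ψ Z - g Z * Θ (Matrix.vecTail Z)‖₊ : ℝ≥0∞) ^ 2 := hA.const_mul 2
  have hpt : ∀ Z : Config (N + 1), (‖Ψ Z - c * g Z * Θ' (Matrix.vecTail Z)‖₊ : ℝ≥0∞) ^ 2 ≤
      2 * (‖Ψ Z - g Z * Θ (Matrix.vecTail Z)‖₊ : ℝ≥0∞) ^ 2 +
        2 * ENNReal.ofReal (M ^ 2) * F (Matrix.vecTail Z) := by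
    intro Z
    rw [hFdef]
    exact pointwise_influence_bound _ _ _ _ _ (hgM Z)
  have hI : ∫⁻ X, (‖Θ X - c * Θ' X‖₊ : ℝ≥0∞) ^ 2 = ∫⁻ X, F X := by rw [hFdef]
  rw [hI]
  calc ∫⁻ Z in boxN (N + 1) L, (‖Ψ Z - c * g Z * Θ' (Matrix.vecTail Z)‖₊ : ℝ≥0∞) ^ 2
      ≤ ∫⁻ Z in boxN (N + 1) L, (2 * (‖Ψ Z - g Z * Θ (Matrix.vecTail Z)‖₊ : ℝ≥0∞) ^ 2 +
          2 * ENNReal.ofReal (M ^ 2) * F (Matrix.vecTail Z)) := lintegral_mono fun Z => hpt Z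
    _ = 2 * (∫⁻ Z in boxN (N + 1) L, (‖Ψ Z - g Z * Θ (Matrix.vecTail Z)‖₊ : ℝ≥0∞) ^ 2) +
          2 * ENNReal.ofReal (M ^ 2) * ∫⁻ Z in boxN (N + 1) L, F (Matrix.vecTail Z) := by
        rw [lintegral_add_left hA2, lintegral_const_mul _ hFt, lintegral_const_mul _ hA]
    _ = 2 * (∫⁻ Z in boxN (N + 1) L, (‖Ψ Z - g Z * Θ (Matrix.vecTail Z)‖₊ : ℝ≥0∞) ^ 2) +
          2 * (ENNReal.ofReal (M ^ 2) * ENNReal.ofReal L ^ 3) * ∫⁻ X in boxN N L, F X := by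
        rw [setLIntegral_boxN_succ_comp_vecTail L hFm]
        ring
    _ ≤ 2 * (∫⁻ Z in boxN (N + 1) L, (‖Ψ Z - g Z * Θ (Matrix.vecTail Z)‖₊ : ℝ≥0∞) ^ 2) +
          2 * ENNReal.ofReal (M ^ 2 * L ^ 3) * ∫⁻ X, F X := by
        exact add_le_add le_rfl (mul_le_mul' (mul_le_mul' le_rfl (ofReal_sq_mul_ofReal_pow_three_le M L))
          (setLIntegral_le_lintegral _ _))

/-! ### The stub -/

/-- **Stub 3 (S/M, frame) of line `registered` (skeleton v2) of the crux `SquareSummableInfluence`: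
the influence sum is `L²`-Lipschitz in the bath state.** For measurable `Ψ : Λ^{N+1} → ℂ`,
`Θ, Θ' : Λ^N → ℂ`, measurable predictors `g_i` with `‖g_i‖ ≤ M` and a scalar `c`:
`∑_i ∫_{Λ_L^{N+1}} |Ψ − c g_i Θ'(tail)|² ≤ 2 ∑_i ∫_{Λ_L^{N+1}} |Ψ − g_i Θ(tail)|² + 2 N M² L³ ∫ |Θ − c Θ'|²`
(pointwise `|a+b|² ≤ 2|a|²+2|b|²`, `|g_i| ≤ M`, Tonelli `Λ^{N+1} ≃ Λ × Λ^N`, `vol Λ = L³`).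
[folklore] -/
theorem stub_influenceLipschitz :
    ∀ (N : ℕ) (L : ℝ) (Ψ : Config (N + 1) → ℂ) (Θ Θ' : Config N → ℂ)
      (g : Fin N → Config (N + 1) → ℂ) (M : ℝ) (c : ℂ),
      Measurable Ψ → Measurable Θ → Measurable Θ' → (∀ i, Measurable (g i)) →
      (∀ i Z, ‖g i Z‖ ≤ M) →
        (∑ i : Fin N, ∫⁻ Z in boxN (N + 1) L,
            (‖Ψ Z - c * g i Z * Θ' (Matrix.vecTail Z)‖₊ : ℝ≥0∞) ^ 2) ≤
          2 * (∑ i : Fin N, ∫⁻ Z in boxN (N + 1) L,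
              (‖Ψ Z - g i Z * Θ (Matrix.vecTail Z)‖₊ : ℝ≥0∞) ^ 2) +
            2 * (N : ℝ≥0∞) * ENNReal.ofReal (M ^ 2 * L ^ 3) *
              ∫⁻ X, (‖Θ X - c * Θ' X‖₊ : ℝ≥0∞) ^ 2 := by
  intro N L Ψ Θ Θ' g M c hΨ hΘ hΘ' hg hgM
  calc (∑ i : Fin N, ∫⁻ Z in boxN (N + 1) L,
          (‖Ψ Z - c * g i Z * Θ' (Matrix.vecTail Z)‖₊ : ℝ≥0∞) ^ 2)
      ≤ ∑ i : Fin N, (2 * (∫⁻ Z in boxN (N + 1) L,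
            (‖Ψ Z - g i Z * Θ (Matrix.vecTail Z)‖₊ : ℝ≥0∞) ^ 2) +
          2 * ENNReal.ofReal (M ^ 2 * L ^ 3) * ∫⁻ X, (‖Θ X - c * Θ' X‖₊ : ℝ≥0∞) ^ 2) :=
        Finset.sum_le_sum fun i _ =>
          influence_term_bound N L Ψ Θ Θ' (g i) M c hΨ hΘ hΘ' (hg i) (hgM i)
    _ = 2 * (∑ i : Fin N, ∫⁻ Z in boxN (N + 1) L,
            (‖Ψ Z - g i Z * Θ (Matrix.vecTail Z)‖₊ : ℝ≥0∞) ^ 2) +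
          (N : ℝ≥0∞) * (2 * ENNReal.ofReal (M ^ 2 * L ^ 3) *
            ∫⁻ X, (‖Θ X - c * Θ' X‖₊ : ℝ≥0∞) ^ 2) := by
        rw [Finset.sum_add_distrib, ← Finset.mul_sum, Finset.sum_const, Finset.card_univ,
          Fintype.card_fin, nsmul_eq_mul]
    _ = _ := by ring

end Summit.AtomisticToContinuum.BoseEinsteinCondensation.Theorems.SquareSummableInfluence
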